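import Summits.CriticalPhenomena.SAWScalingLimit.Theses.SAWDevelopingMap
import Summits.CriticalPhenomena.SAWScalingLimit.Theorems.ObservableToSLE.Negative.Identification
import Summits.CriticalPhenomena.SAWScalingLimit.Theorems.SAWDefectDecoherenceObservableToSLEROrientation
import Summits.CriticalPhenomena.SAWScalingLimit.Theorems.SAWDefectDecoherenceObservableToSLEROrientationCoOrientedLattice
import Summits.CriticalPhenomena.SAWScalingLimit.Theorems.SAWDefectDecoherenceObservableToSLERGateDefs
import Summits.CriticalPhenomena.SAWScalingLimit.Theorems.SAWDefectDecoherenceObservableToSLERGateDecomposition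
import Summits.CriticalPhenomena.SAWScalingLimit.Theorems.SAWDefectDecoherenceObservableToSLERSLELawContinuity
import Summits.CriticalPhenomena.SAWScalingLimit.Theorems.SAWDefectDecoherenceObservableToSLERNestedGateDefs
import Summits.CriticalPhenomena.SAWScalingLimit.Theorems.SAWDefectDecoherenceObservableToSLERNestedLinkDefs
import Summits.CriticalPhenomena.SAWScalingLimit.Theorems.SAWDefectDecoherenceObservableToSLERMidTightN
import Summits.CriticalPhenomena.SAWScalingLimit.Theorems.SAWDefectDecoherenceObservableToSLERNestedTransferP
import Summits.CriticalPhenomena.SAWScalingLimit.Theorems.SAWDefectDecoherenceObservableToSLERSeqReductionPM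
import Summits.CriticalPhenomena.SAWScalingLimit.Theorems.SAWDefectDecoherenceObservableToSLERMidModulusN
import Summits.CriticalPhenomena.SAWScalingLimit.Theorems.SAWDefectDecoherenceObservableToSLERTwoPieceRestrictionLimit
import Summits.CriticalPhenomena.SAWScalingLimit.Theorems.SAWDevelopingMapObservableToSLETypeLadderCoOrientedReduction
import Summits.CriticalPhenomena.SAWScalingLimit.Theorems.SAWDevelopingMapObservableToSLETypeLadderNestedTransferPR
import Summits.CriticalPhenomena.SAWScalingLimit.Theorems.SAWDevelopingMapObservableToSLETypeLadderCarvedReductionAssembly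
import Summits.CriticalPhenomena.SAWScalingLimit.Theorems.SAWDevelopingMapObservableToSLETypeLadderTwoPieceAdmIdentification
import Summits.CriticalPhenomena.SAWScalingLimit.Theorems.SAWDefectDecoherenceObservableToSLERModulusOfSimpleLimits
import Summits.CriticalPhenomena.SAWScalingLimit.Theorems.SAWDevelopingMapObservableToSLETypeLadderCarvedReductionSqueezeRatio
import Summits.CriticalPhenomena.SAWScalingLimit.Theorems.SAWDevelopingMapObservableToSLETypeLadderCarvedReductionAssemblyP
import Summits.CriticalPhenomena.SAWScalingLimit.Theorems.SAWDefectDecoherenceObservableToSLERCoOrientedReductionSolid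
import Summits.CriticalPhenomena.SAWScalingLimit.Theorems.SAWDevelopingMapObservableToSLETypeLadderCarvedReductionSqueezeSelection
import Summits.CriticalPhenomena.SAWScalingLimit.Theorems.SAWDevelopingMapObservableToSLETypeLadderCarvedReductionSqueezeLattice
import HarnessLib
import HarnessLib.Audit

/-!
# Line `macro-anchor-split` — crux `SAWDevelopingMap.ObservableToSLE` (stmt-CriticalPhenomena-10472)
(ALTERNATIVE line registered by the crux-strategist seat `planner-cstrat-stmt-CriticalPhenomena-10472-s3-0`,
2026-08-17; it does NOT overwrite the live skeleton `Lines/six_class_type_ladder.lean` of lead c5 — it RIDES on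
it, exactly as that skeleton rides on the twin crux 14005's `bridge-gate-renewal` frame)

IDEA.  The live line r10 closes the crux modulo S1 (abundance), T1 (K-uniform anchor), T5ₐ (simplicity, = item
7148) and the provable squeeze leaf.  This line is the same architecture with its FOUR OPEN STUBS CUT ALONG THE
CRUX'S HONEST SEAMS and ONE mathematical change — the anchor is WEAKENED to the weakest form the assembly consumes:

* `stub_nestedRenewalFatCoSolidR` — = live S1, SAME name and signature (shared: whichever lands closes both);
* `stub_macroSourceLocality` — NEW, MACROSCOPIC SOURCE LOCALITY: ∀ ε ∀ r > 0 ∃ t₀, far mass beyond the FIXED r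
  of the chords a → s_t is ≤ ε · total, with the consumer's full admissibility package (connected, exhausting)
  as hypotheses.  Implied by the K-uniform T1 (`macroSourceLocality_of_twoPieceSourceLocality`, proved here),
  SUFFICIENT for the two-piece admissible restriction limit (`macroRestrictionLimit`, proved here: twin 5a2
  p121515 re-run with K|t| ↦ ρ/4), and — unlike T1 (crux `Disproof.lean` §10.4: escape to infinity is
  invisible to bounded-domain laws) — Conjecture-1-locked in substance (LSW restriction: chordal SLE(8/3)
  between merging boundary points stays local).  So the line's research residue {abundance, macro locality,
  simplicity} has exactly ONE member not implied by DCS Conjecture 1 (abundance), instead of two;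
* `stub_hexSimpleSubseqLimits` — = live T5ₐ = item stmt-CriticalPhenomena-7148, SAME name and signature;
* `stub_carvedIdentificationSolid` — NEW provable (XL): ARL″ ⟹ `CarvedSeqIdentificationPM FatAnchoredClassZeroSolid`
  (both inlined).  It is the live glue T2b one level up: `carvedIdentificationSolid_of_squeezeSolid` (proved
  here) derives it from the live T2b″ `stub_carvedReduction_squeezeSolid` with the landed T2a p126992, T2c
  p130700 and Radó continuity p81676 — so the lead's wave on the squeeze geometry closes it unchanged.

COMPOSITION `ObservableToSLE_of` (sorry-free over the stubs, concludes the crux BY NAME): `macroRestrictionLimit`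
(ARL″) → stub 4 (class-(0,0) carved identification) → `CoOrientedSolid.stub_coOrientedReductionSolid` (twin,
landed) → with `Modulus.stub_hexUniformModulus_of_simpleLimits` (p127640) + `NestedGate.stub_midTightN` (p116996)
+ `stub_midModulusN` (p120791) + `stub_seqReductionPM` (p120538): carved convergence under the co-oriented solid
constraint → `TypeLadder.stub_nestedTransferPR` (p124665) with `BridgeGate.stub_gateDecomposition` (p82259) and
stub 1 → identification of every subsequential limit → `Negative.convergesInLawToSLE_of_identification` (p69742)
with `HexTight`.  The same composition, hypotheses explicit, is `ObservableToSLE_of_subs` in the evidence file (the route-level split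
glue; the gate refused `route edit --split` from a non-final strategist cycle, so the split is embodied HERE and in
the evidence file `SAWDevelopingMapObservableToSLESplit.lean` on the crux item, children.json in the seat folder).

WHY IT DODGES THE STUCK GOAL.  Nothing is stuck on a goal; the lead's last 6 h went into the provable squeeze
geometry (25+ pieces landed under non-stub names).  What this line changes is the RESEARCH surface: T1, the one
stub a disprover could kill without touching Conjecture 1, is no longer load-bearing.

Disproof.lean honoured: §1 (no `_false_without_`; both hypotheses consumed — `HexObservableLimit` only inside
`macroRestrictionLimit`, `HexTight` through MidTightN/modulus and the final criterion); W1/W2/RootSilence (clean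
flat gates, inherited); §10.4 (the anchor necessity gap) — ANSWERED by the weakening; `Negative.ModulusNecessity`
/ `ChordalCarrier` (stub 3 is Conj.1-locked, unchanged); `TypeLadder.stub_not_nestedRenewalP` (locality scale
bounded, inherited r3 typing); twin `NegativeNote-RenewalAccumulation-g2` (families chosen after the mesh).
Card: `Lines/macro-anchor-split.md`.  Census: `STRATEGY-CENSUS.md`.
-/

noncomputable section

open scoped BigOperators Topology NNReal ENNReal Classical BoundedContinuousFunction ComplexConjugate
open Filter Set MeasureTheory Metric
open Literature.Probability.LatticeModels (HexVertex hexGraph hexCenter triZeta Site polyline)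
open Literature.Probability.RandomPlanarGeometry
open Literature.Probability.RandomPlanarGeometry.SAW
open UpperHalfPlane (upperHalfPlaneSet)

namespace Summit.CriticalPhenomena.SAWScalingLimit.Cruxes.ObservableToSLE.MacroAnchorSplit

open Summit.CriticalPhenomena.SAWScalingLimit.Theses.SAWDevelopingMap
  (HexObservableLimit HexTight ObservableToSLE)
open Summit.CriticalPhenomena.SAWScalingLimit.Theorems.ObservableToSLER.BridgeGate
open Summit.CriticalPhenomena.SAWScalingLimit.Theorems.ObservableToSLER.NestedGate
open Summit.CriticalPhenomena.SAWScalingLimit.Theorems.ObservableToSLE.FloorRatio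
  (exists_conformalPackage flat_of_subset tendsto_of_forall_squeeze exists_remark
    stub_targetTransport norm_exp_five_eighths sum_pow_length_pos exists_injective_verts_eq
    archMass_mono)
open Summit.CriticalPhenomena.SAWScalingLimit.Theorems.ObservableToSLER.TwoPiece
  (norm_observable_eq_archMass archMass_le_archMass_add_farMass_mesh twoPieceFloorData)

/-! ## §1 The macroscopic anchor suffices for the two-piece admissible restriction limit -/

/-- The `K`-uniform anchor of the live lines (`TwoPieceSourceLocality`, twin r7 stub 5a1 = T1, same
text) implies the macroscopic one: given `r`, take `t₀' = min t₀ (r / K)`, so that `K |t| < r`. -/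
theorem macroSourceLocality_of_twoPieceSourceLocality :
    (∀ (E : DobrushinDomain) (ρ : ℝ) (Λ : ℝ → Finset HexVertex) (m₀ : ℝ → ℤ)
      (a : ℝ → Sym2 HexVertex),
      0 < ρ → E.carrier ∩ ball (E.pt 0) ρ = {z : ℂ | (E.pt 0).im < z.im} ∩ ball (E.pt 0) ρ →
      (∀ᶠ δ : ℝ in 𝓝[>] 0, hexDomainSimplyConnected (Λ δ) ∧ a δ ∈ hexDomainBoundary (Λ δ) ∧
        (∀ v ∈ Λ δ, (δ : ℂ) * hexCenter v ∈ E.carrier) ∧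
        (∀ v : HexVertex, (δ : ℂ) * hexCenter v ∈ ball (E.pt 0) ρ → (v ∈ Λ δ ↔ m₀ δ ≤ v.1 1))) →
      Tendsto (fun δ : ℝ => (δ : ℂ) * hexMidpoint (a δ)) (𝓝[>] 0) (𝓝 (E.pt 0)) →
      ∀ ε : ℝ, 0 < ε → ∃ K : ℝ, 0 < K ∧ ∃ t₀ : ℝ, 0 < t₀ ∧
        ∀ (s : ℝ → Sym2 HexVertex) (t : ℝ), t ≠ 0 → |t| < t₀ →
          (∀ᶠ δ : ℝ in 𝓝[>] 0, s δ ∈ hexDomainBoundary (Λ δ) ∧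
            (hexMidpoint (s δ)).im = (hexMidpoint (a δ)).im) →
          Tendsto (fun δ : ℝ => (δ : ℂ) * hexMidpoint (s δ)) (𝓝[>] 0) (𝓝 (E.pt 0 + t)) →
          ∀ᶠ δ : ℝ in 𝓝[>] 0,
            (∑ γ : HexMidEdgeSAW (Λ δ) (a δ) (s δ),
                if ∃ v ∈ γ.verts, K * |t| ≤ dist ((δ : ℂ) * hexCenter v) ((δ : ℂ) * hexMidpoint (a δ))
                then hexCriticalFugacity ^ γ.length else 0) ≤
              ε * ∑ γ : HexMidEdgeSAW (Λ δ) (a δ) (s δ), hexCriticalFugacity ^ γ.length) →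
    (∀ (E : DobrushinDomain) (ρ : ℝ) (Λ : ℝ → Finset HexVertex) (m₀ : ℝ → ℤ)
      (a : ℝ → Sym2 HexVertex),
      0 < ρ → E.carrier ∩ ball (E.pt 0) ρ = {z : ℂ | (E.pt 0).im < z.im} ∩ ball (E.pt 0) ρ →
      (∀ᶠ δ : ℝ in 𝓝[>] 0, hexDomainSimplyConnected (Λ δ) ∧
        (hexGraph.induce (↑(Λ δ) : Set HexVertex)).Preconnected ∧ a δ ∈ hexDomainBoundary (Λ δ) ∧
        (∀ v ∈ Λ δ, (δ : ℂ) * hexCenter v ∈ E.carrier) ∧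
        (∀ v : HexVertex, (δ : ℂ) * hexCenter v ∈ ball (E.pt 0) ρ → (v ∈ Λ δ ↔ m₀ δ ≤ v.1 1))) →
      (∀ K : Set ℂ, IsCompact K → K ⊆ E.carrier →
        ∀ᶠ δ : ℝ in 𝓝[>] 0, ∀ v : HexVertex, (δ : ℂ) * hexCenter v ∈ K → v ∈ Λ δ) →
      Tendsto (fun δ : ℝ => (δ : ℂ) * hexMidpoint (a δ)) (𝓝[>] 0) (𝓝 (E.pt 0)) →
      ∀ ε : ℝ, 0 < ε → ∀ r : ℝ, 0 < r → ∃ t₀ : ℝ, 0 < t₀ ∧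
        ∀ (s : ℝ → Sym2 HexVertex) (t : ℝ), t ≠ 0 → |t| < t₀ →
          (∀ᶠ δ : ℝ in 𝓝[>] 0, s δ ∈ hexDomainBoundary (Λ δ) ∧
            (hexMidpoint (s δ)).im = (hexMidpoint (a δ)).im) →
          Tendsto (fun δ : ℝ => (δ : ℂ) * hexMidpoint (s δ)) (𝓝[>] 0) (𝓝 (E.pt 0 + t)) →
          ∀ᶠ δ : ℝ in 𝓝[>] 0,
            (∑ γ : HexMidEdgeSAW (Λ δ) (a δ) (s δ),
                if ∃ v ∈ γ.verts, r ≤ dist ((δ : ℂ) * hexCenter v) ((δ : ℂ) * hexMidpoint (a δ))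
                then hexCriticalFugacity ^ γ.length else 0) ≤
              ε * ∑ γ : HexMidEdgeSAW (Λ δ) (a δ) (s δ), hexCriticalFugacity ^ γ.length) := by
  intro hSL E ρ Λ m₀ a hρ hflat hev _hK ha ε hε r hr
  obtain ⟨K, hK, t₀, ht₀, h⟩ := hSL E ρ Λ m₀ a hρ hflat
    (hev.mono fun δ h => ⟨h.1, h.2.2.1, h.2.2.2.1, h.2.2.2.2⟩) ha ε hε
  refine ⟨min t₀ (r / K), lt_min ht₀ (div_pos hr hK), fun s t ht htlt hs hst => ?_⟩
  have ht₀' : |t| < t₀ := htlt.trans_le (min_le_left _ _)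
  have hKt : K * |t| < r := by
    have := htlt.trans_le (min_le_right _ _)
    rwa [lt_div_iff₀ hK, mul_comm] at this
  filter_upwards [h s t ht ht₀' hs hst] with δ hδ
  refine le_trans (Finset.sum_le_sum fun γ _ => ?_) hδ
  by_cases hfar : ∃ v ∈ γ.verts, r ≤ dist ((δ : ℂ) * hexCenter v) ((δ : ℂ) * hexMidpoint (a δ))
  · obtain ⟨v, hv, hvd⟩ := hfar
    have hK' : ∃ v ∈ γ.verts,
        K * |t| ≤ dist ((δ : ℂ) * hexCenter v) ((δ : ℂ) * hexMidpoint (a δ)) :=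
      ⟨v, hv, hKt.le.trans hvd⟩
    rw [if_pos ⟨v, hv, hvd⟩, if_pos hK']
  · rw [if_neg hfar]
    split_ifs
    · exact pow_nonneg hexCriticalFugacity_pos_lt_one.1.le _
    · exact le_rfl

/-- **The two-piece admissible restriction limit from the MACROSCOPIC anchor**:
`HexObservableLimit → MacroSourceLocality → TwoPieceAdmRestrictionLimit` (the conclusion is the twin
r7 statement ARL″ verbatim, = the registered stub signature of T2a's input).  Proof: the landed 5a2
bootstrap (`ObservableToSLER.TwoPiece.stub_twoPieceAdmRestrictionLimit`, p121515) with the far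
threshold `K |t|` replaced by the fixed radius `ρ / 4` inside the common flat ball at `pt 0` — target
transport twice (`FloorRatio.stub_targetTransport`), boundary winding rigidity, coalescence
`R(t) → Φ_A'(0)^{5/8}`, and the squeeze `1 - η ≤ Z_{Λ'}(a,s)/Z_Λ(a,s) ≤ 1` from macroscopic
source locality (the near chords within `ρ/4` of `a` are chords of `Λ'`).
[cite: LawlerSchrammWerner2003Restriction, Thm. 6.1 (p. 23)] -/
theorem macroRestrictionLimit :
    HexObservableLimit →
    (∀ (E : DobrushinDomain) (ρ : ℝ) (Λ : ℝ → Finset HexVertex) (m₀ : ℝ → ℤ)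
      (a : ℝ → Sym2 HexVertex),
      0 < ρ → E.carrier ∩ ball (E.pt 0) ρ = {z : ℂ | (E.pt 0).im < z.im} ∩ ball (E.pt 0) ρ →
      (∀ᶠ δ : ℝ in 𝓝[>] 0, hexDomainSimplyConnected (Λ δ) ∧
        (hexGraph.induce (↑(Λ δ) : Set HexVertex)).Preconnected ∧ a δ ∈ hexDomainBoundary (Λ δ) ∧
        (∀ v ∈ Λ δ, (δ : ℂ) * hexCenter v ∈ E.carrier) ∧
        (∀ v : HexVertex, (δ : ℂ) * hexCenter v ∈ ball (E.pt 0) ρ → (v ∈ Λ δ ↔ m₀ δ ≤ v.1 1))) →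
      (∀ K : Set ℂ, IsCompact K → K ⊆ E.carrier →
        ∀ᶠ δ : ℝ in 𝓝[>] 0, ∀ v : HexVertex, (δ : ℂ) * hexCenter v ∈ K → v ∈ Λ δ) →
      Tendsto (fun δ : ℝ => (δ : ℂ) * hexMidpoint (a δ)) (𝓝[>] 0) (𝓝 (E.pt 0)) →
      ∀ ε : ℝ, 0 < ε → ∀ r : ℝ, 0 < r → ∃ t₀ : ℝ, 0 < t₀ ∧
        ∀ (s : ℝ → Sym2 HexVertex) (t : ℝ), t ≠ 0 → |t| < t₀ →
          (∀ᶠ δ : ℝ in 𝓝[>] 0, s δ ∈ hexDomainBoundary (Λ δ) ∧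
            (hexMidpoint (s δ)).im = (hexMidpoint (a δ)).im) →
          Tendsto (fun δ : ℝ => (δ : ℂ) * hexMidpoint (s δ)) (𝓝[>] 0) (𝓝 (E.pt 0 + t)) →
          ∀ᶠ δ : ℝ in 𝓝[>] 0,
            (∑ γ : HexMidEdgeSAW (Λ δ) (a δ) (s δ),
                if ∃ v ∈ γ.verts, r ≤ dist ((δ : ℂ) * hexCenter v) ((δ : ℂ) * hexMidpoint (a δ))
                then hexCriticalFugacity ^ γ.length else 0) ≤
              ε * ∑ γ : HexMidEdgeSAW (Λ δ) (a δ) (s δ), hexCriticalFugacity ^ γ.length) →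
    ∀ (D D' : DobrushinDomain) (ρ : ℝ) (φ : ConformalEquiv upperHalfPlaneSet D.carrier)
      (Φ : ConformalEquiv (upperHalfPlaneSet \ φ.pullbackHull D') upperHalfPlaneSet) (d : ℝ)
      (Λ Λ' : ℝ → Finset HexVertex) (m₀ m₁ m₁' : ℝ → ℤ) (a b : ℝ → Sym2 HexVertex),
      (0 < ρ ∧ ∀ i : Fin 2, D.carrier ∩ ball (D.pt i) ρ = {z : ℂ | (D.pt i).im < z.im} ∩ ball (D.pt i) ρ) →
      D.IsHullSubdomain D' → D.IsChordalUniformizing φ →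
      IsRestrictionMap (φ.pullbackHull D') Φ → HasRestrictionDeriv (φ.pullbackHull D') Φ d →
      (∀ᶠ δ : ℝ in 𝓝[>] 0,
        Λ' δ ⊆ Λ δ ∧ hexDomainSimplyConnected (Λ δ) ∧ hexDomainSimplyConnected (Λ' δ) ∧
        (hexGraph.induce (↑(Λ δ) : Set HexVertex)).Preconnected ∧
        (hexGraph.induce (↑(Λ' δ) : Set HexVertex)).Preconnected ∧
        a δ ∈ hexDomainBoundary (Λ δ) ∧ b δ ∈ hexDomainBoundary (Λ δ) ∧
        a δ ∈ hexDomainBoundary (Λ' δ) ∧ b δ ∈ hexDomainBoundary (Λ' δ) ∧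
        Nonempty (HexMidEdgeSAW (Λ' δ) (a δ) (b δ)) ∧
        (∀ v ∈ Λ δ, (δ : ℂ) * hexCenter v ∈ D.carrier) ∧
        (∀ v ∈ Λ' δ, (δ : ℂ) * hexCenter v ∈ D'.carrier) ∧
        (∀ v : HexVertex, (δ : ℂ) * hexCenter v ∈ ball (D.pt 0) ρ →
          ((v ∈ Λ δ ↔ m₀ δ ≤ v.1 1) ∧ (v ∈ Λ' δ ↔ m₀ δ ≤ v.1 1))) ∧
        (∀ v : HexVertex, (δ : ℂ) * hexCenter v ∈ ball (D.pt 1) ρ →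
          ((v ∈ Λ δ ↔ m₁ δ ≤ v.1 1) ∧ (v ∈ Λ' δ ↔ m₁' δ ≤ v.1 1)))) →
      (∀ K : Set ℂ, IsCompact K → K ⊆ D.carrier →
        ∀ᶠ δ : ℝ in 𝓝[>] 0, ∀ v : HexVertex, (δ : ℂ) * hexCenter v ∈ K → v ∈ Λ δ) →
      (∀ K : Set ℂ, IsCompact K → K ⊆ D'.carrier →
        ∀ᶠ δ : ℝ in 𝓝[>] 0, ∀ v : HexVertex, (δ : ℂ) * hexCenter v ∈ K → v ∈ Λ' δ) →
      Tendsto (fun δ : ℝ => (δ : ℂ) * hexMidpoint (a δ)) (𝓝[>] 0) (𝓝 (D.pt 0)) →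
      Tendsto (fun δ : ℝ => (δ : ℂ) * hexMidpoint (b δ)) (𝓝[>] 0) (𝓝 (D.pt 1)) →
      Tendsto (fun δ : ℝ =>
          (∑ γ : HexMidEdgeSAW (Λ' δ) (a δ) (b δ), hexCriticalFugacity ^ γ.length) /
            (∑ γ : HexMidEdgeSAW (Λ δ) (a δ) (b δ), hexCriticalFugacity ^ γ.length)) (𝓝[>] 0)
        (𝓝 (d ^ ((5 : ℝ) / 8))) := by
  intro hO hSL D D' ρ φ Φ d Λ Λ' m₀ m₁ m₁' a b hfl hD' hφ hΦ hd hev hKΛ hKΛ' ha hb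
  obtain ⟨hρ, hflat⟩ := hfl
  have hflat0 := hflat 0
  have hflat1 := hflat 1
  obtain ⟨Ψ, L, Lb, Ψ', L', L'b, ρ₁, R, hρ₁, hρ₁ρ, hΨinf, hΨb, hLc, hLe, hLb, hΨ'inf, hΨ'b, hL'c,
    hL'e, hL'b, hflat0', hflat1', hfloor, hR⟩ :=
    exists_conformalPackage D D' ρ φ Φ d hρ hflat0 hflat1 hD' hφ hΦ hd
  -- two-piece source locality in the ball at `pt 0`, for the family `Λ`
  have hSLD := hSL D ρ Λ m₀ a hρ hflat0 (by
      filter_upwards [hev] with δ hevδ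
      obtain ⟨-, hscΛ, -, hconn, -, haΛ, -, -, -, -, hΛD, -, hrows0, -⟩ := hevδ
      exact ⟨hscΛ, hconn, haΛ, hΛD, fun v hv => (hrows0 v hv).1⟩) hKΛ ha
  refine tendsto_of_forall_squeeze fun η hη => ?_
  -- macroscopic source locality at the FIXED radius `ρ / 4`
  obtain ⟨t₀, ht₀, hSLK⟩ := hSLD η hη (ρ / 4) (by positivity)
  -- choice of the floor point `s = a + t`
  obtain ⟨t, ht0, htρ, htt₀, htR⟩ : ∃ t : ℝ, 0 < t ∧ t < ρ₁ / 4 ∧ t < t₀ ∧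
      |R t - d ^ ((5 : ℝ) / 8)| ≤ η := by
    have h1 : ∀ᶠ t in 𝓝[>] (0 : ℝ), t < ρ₁ / 4 := mem_nhdsWithin_of_mem_nhds (Iio_mem_nhds (by positivity))
    have h3 : ∀ᶠ t in 𝓝[>] (0 : ℝ), t < t₀ := mem_nhdsWithin_of_mem_nhds (Iio_mem_nhds ht₀)
    have h4 : ∀ᶠ t in 𝓝[>] (0 : ℝ), |R t - d ^ ((5 : ℝ) / 8)| ≤ η := by
      filter_upwards [Metric.tendsto_nhds.1 hR η hη] with t ht
      rw [Real.dist_eq] at ht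
      exact ht.le
    obtain ⟨t, ⟨h1t, h3t, h4t⟩, ht0⟩ :=
      ((h1.and (h3.and h4)).and self_mem_nhdsWithin).exists
    exact ⟨t, ht0, h1t, h3t, h4t⟩
  obtain ⟨hsfr, hsfr', hsa, Ls, L's, hLs, hL's, hRt⟩ := hfloor t ht0 (by linarith)
  set s : ℂ := D.pt 0 + t with hs
  have hsim : s.im = (D.pt 0).im := by simp [hs]
  have hdist_s : dist s (D.pt 0) = t := by
    rw [hs, dist_eq_norm, add_sub_cancel_left, Complex.norm_real, Real.norm_eq_abs, abs_of_pos ht0]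
  have htabs : |t| = t := abs_of_pos ht0
  have hKt : 2 * (ρ / 4) < ρ := by linarith
  -- the local lattice floor data at `pt 0`
  obtain ⟨sE, hsE, hevF⟩ := twoPieceFloorData (p := D.pt 0) Λ Λ' m₀ a hρ
    (by
      filter_upwards [hev] with δ hevδ
      obtain ⟨-, -, -, hconn, hconn', haΛ, -, -, -, -, -, -, hrows0, -⟩ := hevδ
      exact ⟨hconn, hconn', haΛ, hrows0⟩)
    ha hsa hsim (by rw [hdist_s]; linarith) hKt
  -- re-marked domains `(D; a, s)`, `(D'; a, s)`
  obtain ⟨Ds, hDs_car, hDs0, hDs1⟩ := exists_remark D hsfr hsa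
  obtain ⟨D's, hD's_car, hD's0, hD's1⟩ := exists_remark D' hsfr' (by rw [hD'.pt_zero_eq]; exact hsa)
  -- the transport radius `ρ₂ = ρ₁/2` and flatness
  have hballs : ball s (ρ₁ / 2) ⊆ ball (D.pt 0) ρ₁ := by
    intro z hz
    rw [mem_ball] at hz ⊢
    calc dist z (D.pt 0) ≤ dist z s + dist s (D.pt 0) := dist_triangle _ _ _
      _ < ρ₁ / 2 + t := by rw [hdist_s]; linarith
      _ ≤ ρ₁ := by linarith
  have hballsρ : ball s (ρ₁ / 2) ⊆ ball (D.pt 0) ρ := hballs.trans (ball_subset_ball hρ₁ρ)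
  have hρ₂ρ : ρ₁ / 2 ≤ ρ := by linarith
  have hf0 := flat_of_subset hflat0 (ball_subset_ball hρ₂ρ) rfl
  have hf1 := flat_of_subset hflat1 (ball_subset_ball hρ₂ρ) rfl
  have hfs := flat_of_subset hflat0 hballsρ hsim
  have hf0' := flat_of_subset hflat0' (ball_subset_ball (by linarith : ρ₁ / 2 ≤ ρ₁)) rfl
  have hf1' := flat_of_subset hflat1' (ball_subset_ball (by linarith : ρ₁ / 2 ≤ ρ₁)) rfl
  have hfs' := flat_of_subset hflat0' hballs hsim
  -- nonempty walk spaces `a δ → b δ` in `Λ δ`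
  have hevN : ∀ᶠ δ : ℝ in 𝓝[>] 0, Nonempty (HexMidEdgeSAW (Λ δ) (a δ) (b δ)) := by
    filter_upwards [hev] with δ hevδ
    obtain ⟨hsubΛ, -, -, -, -, -, -, -, -, hne', -⟩ := hevδ
    obtain ⟨ι, -, -⟩ := exists_injective_verts_eq hsubΛ (a δ) (b δ)
    exact hne'.map ι
  -- target transport in `(D; a; b, s)` with `Λ`
  have T₁ : Tendsto (fun δ : ℝ =>
      hexParafermionicObservable (Λ δ) (a δ) hexCriticalFugacity (5 / 8) (sE δ) /
        hexParafermionicObservable (Λ δ) (a δ) hexCriticalFugacity (5 / 8) (b δ)) (𝓝[>] 0)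
      (𝓝 (Complex.exp ((5 / 8 : ℂ) * (Ls - Lb)))) := by
    refine stub_targetTransport hO D Ds (ρ₁ / 2) Λ m₀ m₁ m₀ a b sE Ψ L Lb Ls hDs_car hDs0
      (half_pos hρ₁) hf0 hf1 (by rw [hDs1]; exact hfs) ?_ hKΛ ha hb (by rw [hDs1]; exact hsE)
      hΨinf hΨb hLc hLe hLb (by rw [hDs1]; exact hLs)
    filter_upwards [hev, hevF, hevN] with δ hevδ hF hne_ab
    obtain ⟨-, hscΛ, -, hconn, -, haΛ, hbΛ, -, -, -, hΛD, -, hrows0, hrows1⟩ := hevδ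
    obtain ⟨hsEbd, -, hne_as, -, -, -⟩ := hF
    refine ⟨hscΛ, haΛ, hbΛ, hsEbd, hne_ab, hne_as, hconn, hΛD, ?_, ?_, ?_⟩
    · exact fun v hv => (hrows0 v (ball_subset_ball hρ₂ρ hv)).1
    · exact fun v hv => (hrows1 v (ball_subset_ball hρ₂ρ hv)).1
    · intro v hv
      rw [hDs1] at hv
      exact (hrows0 v (hballsρ hv)).1
  -- target transport in `(D'; a; b, s)` with `Λ'`
  have T₂ : Tendsto (fun δ : ℝ =>
      hexParafermionicObservable (Λ' δ) (a δ) hexCriticalFugacity (5 / 8) (sE δ) /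
        hexParafermionicObservable (Λ' δ) (a δ) hexCriticalFugacity (5 / 8) (b δ)) (𝓝[>] 0)
      (𝓝 (Complex.exp ((5 / 8 : ℂ) * (L's - L'b)))) := by
    refine stub_targetTransport hO D' D's (ρ₁ / 2) Λ' m₀ m₁' m₀ a b sE Ψ' L' L'b L's hD's_car hD's0
      (half_pos hρ₁) (by rw [hD'.pt_zero_eq]; exact hf0') (by rw [hD'.pt_one_eq]; exact hf1')
      (by rw [hD's1]; exact hfs') ?_ hKΛ' (by rw [hD'.pt_zero_eq]; exact ha)
      (by rw [hD'.pt_one_eq]; exact hb) (by rw [hD's1]; exact hsE)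
      (by rw [hD'.pt_zero_eq]; exact hΨ'inf) (by rw [hD'.pt_one_eq]; exact hΨ'b) hL'c hL'e
      (by rw [hD'.pt_one_eq]; exact hL'b) (by rw [hD's1]; exact hL's)
    filter_upwards [hev, hevF] with δ hevδ hF
    obtain ⟨-, -, hscΛ', -, hconn', -, -, haΛ', hbΛ', hne', -, hΛ'D', hrows0, hrows1⟩ := hevδ
    obtain ⟨-, hsEbd', -, hne_as', -, -⟩ := hF
    refine ⟨hscΛ', haΛ', hbΛ', hsEbd', hne', hne_as', hconn', hΛ'D', ?_, ?_, ?_⟩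
    · intro v hv
      rw [hD'.pt_zero_eq] at hv
      exact (hrows0 v (ball_subset_ball hρ₂ρ hv)).2
    · intro v hv
      rw [hD'.pt_one_eq] at hv
      exact (hrows1 v (ball_subset_ball hρ₂ρ hv)).2
    · intro v hv
      rw [hD's1] at hv
      exact (hrows0 v (hballsρ hv)).2
  -- the far mass of the chords `a δ → s_δ` beyond `K t` is small (two-piece source locality)
  have hfar := hSLK sE t ht0.ne' (by rw [htabs]; exact htt₀)
    (hevF.mono fun δ hF => ⟨hF.1, hF.2.2.2.2.1⟩) hsE
  -- the squeeze data: `r = Z'(a,s)/Z(a,s)`, `Q = [Z'(a,b)/Z'(a,s)] · [Z(a,s)/Z(a,b)]`, `R = R t`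
  refine ⟨fun δ => (∑ γ : HexMidEdgeSAW (Λ' δ) (a δ) (sE δ), hexCriticalFugacity ^ γ.length) /
      (∑ γ : HexMidEdgeSAW (Λ δ) (a δ) (sE δ), hexCriticalFugacity ^ γ.length),
    fun δ => ((∑ γ : HexMidEdgeSAW (Λ' δ) (a δ) (b δ), hexCriticalFugacity ^ γ.length) /
      (∑ γ : HexMidEdgeSAW (Λ' δ) (a δ) (sE δ), hexCriticalFugacity ^ γ.length)) *
      ((∑ γ : HexMidEdgeSAW (Λ δ) (a δ) (sE δ), hexCriticalFugacity ^ γ.length) /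
      (∑ γ : HexMidEdgeSAW (Λ δ) (a δ) (b δ), hexCriticalFugacity ^ γ.length)),
    R t, htR, ?_, ?_⟩
  · -- `Q → R t`: `Q` is the quotient of the moduli of the two transported ratios
    have hA₂ : ‖Complex.exp ((5 / 8 : ℂ) * (L's - L'b))‖ ≠ 0 := norm_ne_zero_iff.2 (Complex.exp_ne_zero _)
    have hlim := (T₁.norm).div (T₂.norm) hA₂
    have hval : ‖Complex.exp ((5 / 8 : ℂ) * (Ls - Lb))‖ / ‖Complex.exp ((5 / 8 : ℂ) * (L's - L'b))‖ = R t := by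
      rw [norm_exp_five_eighths, norm_exp_five_eighths, ← Real.exp_sub, ← hRt]
      congr 1
      ring
    rw [hval] at hlim
    refine hlim.congr' ?_
    filter_upwards [hev, hevF] with δ hevδ hF
    obtain ⟨-, hscΛ, hscΛ', -, -, haΛ, hbΛ, haΛ', hbΛ', -, -⟩ := hevδ
    obtain ⟨hsEbd, hsEbd', hne_as, hne_as', -, -⟩ := hF
    have h1 := norm_observable_eq_archMass hscΛ haΛ hsEbd (5 / 8)
    have h2 := norm_observable_eq_archMass hscΛ haΛ hbΛ (5 / 8)
    have h3 := norm_observable_eq_archMass hscΛ' haΛ' hsEbd' (5 / 8)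
    have h4 := norm_observable_eq_archMass hscΛ' haΛ' hbΛ' (5 / 8)
    have hpos1 := sum_pow_length_pos hne_as
    have hpos2 := sum_pow_length_pos hne_as'
    simp only [Pi.div_apply, norm_div]
    rw [h1, h2, h3, h4]
    field_simp
  · -- eventually: `f = r · Q` and `1 - η ≤ r ≤ 1`
    filter_upwards [hev, hevF, hevN, hfar, self_mem_nhdsWithin] with δ hevδ hF hne_ab hfarδ hδ
    obtain ⟨hsubΛ, -, -, -, -, haΛ, -, haΛ', -⟩ := hevδ
    obtain ⟨hsEbd, -, hne_as, hne_as', -, hnear⟩ := hF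
    have hZpos := sum_pow_length_pos hne_as
    have hZ'pos := sum_pow_length_pos hne_as'
    have hZab := sum_pow_length_pos hne_ab
    refine ⟨?_, ?_, ?_⟩
    · field_simp
    · -- source locality: the far mass is small, the near walks live in `Λ'`
      have hsplit := archMass_le_archMass_add_farMass_mesh (t := sE δ) (R := ρ / 4) hδ
        (hexDomainBoundary_subset _ haΛ') hnear
      rw [le_div_iff₀ hZpos]
      linarith
    · exact (div_le_one hZpos).2 (archMass_mono hsubΛ (a δ) (sE δ))

/-! ## §2 Child 4 from the live glue stub T2b″ -/

/-- **Child 4 (`CarvedIdentificationSolid`) from the live squeeze stub.**  The moving-carving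
squeeze for solid class-zero families (live T2b″ `stub_carvedReduction_squeezeSolid`, verbatim, first
hypothesis) gives child 4 — ARL″ ⟹ carved sequential identification for solid fat class-zero
families — through the LANDED T2a (`TypeLadder.stub_twoPieceAdmIdentification`, p126992), T2c
(`TypeLadder.stub_carvedReduction_assemblyP`, p130700) and Radó continuity (p81676). -/
theorem carvedIdentificationSolid_of_squeezeSolid :
    ((∀ (D D' : DobrushinDomain) (ρ : ℝ) (φ : ConformalEquiv upperHalfPlaneSet D.carrier)
  (Φ : ConformalEquiv (upperHalfPlaneSet \ φ.pullbackHull D') upperHalfPlaneSet) (d : ℝ)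
  (Λ Λ' : ℝ → Finset HexVertex) (m₀ m₁ m₁' : ℝ → ℤ) (a b : ℝ → Sym2 HexVertex),
  (0 < ρ ∧ ∀ i : Fin 2, D.carrier ∩ ball (D.pt i) ρ = {z : ℂ | (D.pt i).im < z.im} ∩ ball (D.pt i) ρ) →
  D.IsHullSubdomain D' → D.IsChordalUniformizing φ →
  IsRestrictionMap (φ.pullbackHull D') Φ → HasRestrictionDeriv (φ.pullbackHull D') Φ d →
  (∀ᶠ δ : ℝ in 𝓝[>] 0,
    Λ' δ ⊆ Λ δ ∧ hexDomainSimplyConnected (Λ δ) ∧ hexDomainSimplyConnected (Λ' δ) ∧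
    (hexGraph.induce (↑(Λ δ) : Set HexVertex)).Preconnected ∧
    (hexGraph.induce (↑(Λ' δ) : Set HexVertex)).Preconnected ∧
    a δ ∈ hexDomainBoundary (Λ δ) ∧ b δ ∈ hexDomainBoundary (Λ δ) ∧
    a δ ∈ hexDomainBoundary (Λ' δ) ∧ b δ ∈ hexDomainBoundary (Λ' δ) ∧
    Nonempty (HexMidEdgeSAW (Λ' δ) (a δ) (b δ)) ∧
    (∀ v ∈ Λ δ, (δ : ℂ) * hexCenter v ∈ D.carrier) ∧
    (∀ v ∈ Λ' δ, (δ : ℂ) * hexCenter v ∈ D'.carrier) ∧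
    (∀ v : HexVertex, (δ : ℂ) * hexCenter v ∈ ball (D.pt 0) ρ →
      ((v ∈ Λ δ ↔ m₀ δ ≤ v.1 1) ∧ (v ∈ Λ' δ ↔ m₀ δ ≤ v.1 1))) ∧
    (∀ v : HexVertex, (δ : ℂ) * hexCenter v ∈ ball (D.pt 1) ρ →
      ((v ∈ Λ δ ↔ m₁ δ ≤ v.1 1) ∧ (v ∈ Λ' δ ↔ m₁' δ ≤ v.1 1)))) →
  (∀ K : Set ℂ, IsCompact K → K ⊆ D.carrier →
    ∀ᶠ δ : ℝ in 𝓝[>] 0, ∀ v : HexVertex, (δ : ℂ) * hexCenter v ∈ K → v ∈ Λ δ) →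
  (∀ K : Set ℂ, IsCompact K → K ⊆ D'.carrier →
    ∀ᶠ δ : ℝ in 𝓝[>] 0, ∀ v : HexVertex, (δ : ℂ) * hexCenter v ∈ K → v ∈ Λ' δ) →
  Tendsto (fun δ : ℝ => (δ : ℂ) * hexMidpoint (a δ)) (𝓝[>] 0) (𝓝 (D.pt 0)) →
  Tendsto (fun δ : ℝ => (δ : ℂ) * hexMidpoint (b δ)) (𝓝[>] 0) (𝓝 (D.pt 1)) →
  Tendsto (fun δ : ℝ =>
      (∑ γ : HexMidEdgeSAW (Λ' δ) (a δ) (b δ), hexCriticalFugacity ^ γ.length) /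
        (∑ γ : HexMidEdgeSAW (Λ δ) (a δ) (b δ), hexCriticalFugacity ^ γ.length)) (𝓝[>] 0)
    (𝓝 (d ^ ((5 : ℝ) / 8)))) →
(∀ (D : DobrushinDomain) (a b : ℝ → HexVertex), IsEmbEndpointApprox hexGraph hexCenter D a b →
  ∀ η > (0 : ℝ), ∃ R₀ > (0 : ℝ), ∀ R ∈ Set.Ioc (0 : ℝ) R₀, ∀ ρ > (0 : ℝ), ∀ N : ℕ,
      ∀ (δ : ℕ → ℝ) (S T : ℕ → ℕ → Set HexVertex) (n n' : ℕ → ℕ) (q q' : ℕ → HexVertex),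
        Tendsto δ atTop (𝓝[>] 0) →
        (∀ k, TameNestedFamily (δ k) R N (a (δ k)) (S k) ∧
          TameNestedFamily (δ k) R N (b (δ k)) (T k) ∧
          (((∀ i, ExteriorAnchored D.carrier (δ k) (S k i) (a (δ k))) ∧
      (∀ i, ExteriorAnchored D.carrier (δ k) (T k i) (b (δ k))) ∧
      (∀ (i : ℕ) (p q : HexVertex), HasCleanWindow D.carrier (δ k) ρ (S k i) p q →
        rowOf 0 q = rowOf 0 p + 1 ∧
          ∀ x : HexVertex, ((δ k : ℝ) : ℂ) * hexCenter x ∈ ball (((δ k : ℝ) : ℂ) * hexCenter q) ρ →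
            (x ∈ S k i ↔ rowOf 0 x ≤ rowOf 0 p)) ∧
      (∀ (i : ℕ) (p q : HexVertex), HasCleanWindow D.carrier (δ k) ρ (T k i) p q →
        rowOf 0 q = rowOf 0 p + 1 ∧
          ∀ x : HexVertex, ((δ k : ℝ) : ℂ) * hexCenter x ∈ ball (((δ k : ℝ) : ℂ) * hexCenter q) ρ →
            (x ∈ T k i ↔ rowOf 0 x ≤ rowOf 0 p))) ∧
      (∀ (i : ℕ) (p q : HexVertex), HasCleanWindow D.carrier (δ k) ρ (S k i) p q →
        ∃ K : Set ℂ, IsCompact K ∧ IsConnected K ∧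
          ((δ k : ℝ) : ℂ) * hexCenter q - ((ρ / 2 : ℝ) : ℂ) * Complex.I ∈ K ∧ ((δ k : ℝ) : ℂ) * hexCenter (a (δ k)) ∈ K ∧
          ∀ v : HexVertex, Metric.infDist (((δ k : ℝ) : ℂ) * hexCenter v) K ≤ ρ / 4 → v ∈ S k i) ∧
      (∀ (i : ℕ) (p q : HexVertex), HasCleanWindow D.carrier (δ k) ρ (T k i) p q →
        ∃ K : Set ℂ, IsCompact K ∧ IsConnected K ∧
          ((δ k : ℝ) : ℂ) * hexCenter q - ((ρ / 2 : ℝ) : ℂ) * Complex.I ∈ K ∧ ((δ k : ℝ) : ℂ) * hexCenter (b (δ k)) ∈ K ∧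
          ∀ v : HexVertex, Metric.infDist (((δ k : ℝ) : ℂ) * hexCenter v) K ≤ ρ / 4 → v ∈ T k i) ∧
      (∀ i : ℕ, ∃ K : Set ℂ, IsCompact K ∧ IsConnected K ∧ ((δ k : ℝ) : ℂ) * hexCenter (a (δ k)) ∈ K ∧
        (∀ v : HexVertex, Metric.infDist (((δ k : ℝ) : ℂ) * hexCenter v) K ≤ ρ / 8 → v ∈ S k i) ∧
        (∀ v ∈ S k i, ∃ (t w : HexVertex) (r : ℕ), v ∈ hexBall t r ∧ w ∈ hexBall t r ∧
          hexBall t r ⊆ S k i ∧ Metric.infDist (((δ k : ℝ) : ℂ) * hexCenter w) K ≤ ρ / 16)) ∧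
      (∀ i : ℕ, ∃ K : Set ℂ, IsCompact K ∧ IsConnected K ∧ ((δ k : ℝ) : ℂ) * hexCenter (b (δ k)) ∈ K ∧
        (∀ v : HexVertex, Metric.infDist (((δ k : ℝ) : ℂ) * hexCenter v) K ≤ ρ / 8 → v ∈ T k i) ∧
        (∀ v ∈ T k i, ∃ (t w : HexVertex) (r : ℕ), v ∈ hexBall t r ∧ w ∈ hexBall t r ∧
          hexBall t r ⊆ T k i ∧ Metric.infDist (((δ k : ℝ) : ℂ) * hexCenter w) K ≤ ρ / 16)))) →
        (∀ k, ∃ (γ : HexDomainSAW D.carrier (δ k) (a (δ k)) (b (δ k))) (m : ℕ) (p : HexVertex)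
            (m' : ℕ) (p' : HexVertex),
          IsFirstGoodGateN D.carrier (δ k) ρ R (S k) (a (δ k)) γ.walk.support (n k) m p (q k) ∧
          IsFirstGoodGateN D.carrier (δ k) ρ R (T k) (b (δ k)) γ.walk.support.reverse
            (n' k) m' p' (q' k) ∧
          WideLink D.carrier (δ k) ρ (S k (n k) ∪ T k (n' k)) (q k) (q' k)) →
        ∀ ε' > (0 : ℝ), ∀ φ : ℕ → ℕ, StrictMono φ →
          ∃ (ψ : ℕ → ℕ) (M : DobrushinDomain) (τ : ℂ) (ρ' : ℝ) (Λ' : ℝ → Finset HexVertex)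
            (m : Fin 2 → ℝ → ℤ) (a' b' : ℝ → Sym2 HexVertex) (x : ℕ → Site 2)
            (Λ'' : ℕ → Finset HexVertex) (pu pv : ℕ → HexVertex),
            StrictMono ψ ∧
            (∀ t : ℝ, dist (M.boundary t + τ) (D.boundary t) ≤ η) ∧
            dist (M.pt 0 + τ) (D.pt 0) ≤ η ∧ dist (M.pt 1 + τ) (D.pt 1) ≤ η ∧
            (0 < ρ' ∧ ∀ i : Fin 2,
              M.carrier ∩ ball (M.pt i) ρ' = {z : ℂ | (M.pt i).im < z.im} ∩ ball (M.pt i) ρ') ∧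
            (∀ᶠ δ' : ℝ in 𝓝[>] 0, hexDomainSimplyConnected (Λ' δ') ∧
              a' δ' ∈ hexDomainBoundary (Λ' δ') ∧ b' δ' ∈ hexDomainBoundary (Λ' δ') ∧
              Nonempty (HexMidEdgeSAW (Λ' δ') (a' δ') (b' δ')) ∧
              (hexGraph.induce (↑(Λ' δ') : Set HexVertex)).Preconnected ∧
              (∀ v ∈ Λ' δ', (δ' : ℂ) * hexCenter v ∈ M.carrier) ∧
              (∀ i : Fin 2, ∀ v : HexVertex, (δ' : ℂ) * hexCenter v ∈ ball (M.pt i) ρ' →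
                (v ∈ Λ' δ' ↔ m i δ' ≤ v.1 1))) ∧
            (∀ K : Set ℂ, IsCompact K → K ⊆ M.carrier →
              ∀ᶠ δ' : ℝ in 𝓝[>] 0, ∀ v : HexVertex, (δ' : ℂ) * hexCenter v ∈ K → v ∈ Λ' δ') ∧
            Tendsto (fun δ' : ℝ => (δ' : ℂ) * hexMidpoint (a' δ')) (𝓝[>] 0) (𝓝 (M.pt 0)) ∧
            Tendsto (fun δ' : ℝ => (δ' : ℂ) * hexMidpoint (b' δ')) (𝓝[>] 0) (𝓝 (M.pt 1)) ∧
            Tendsto (fun j : ℕ => ((δ (φ (ψ j)) : ℝ) : ℂ) *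
              Literature.Probability.LatticeModels.triEmbed (x j)) atTop (𝓝 τ) ∧
            (∀ j : ℕ,
              (∀ w : HexVertex, w ∈ Λ'' j ↔ ((-(x j) + w.1, w.2) : HexVertex) ∈ Λ' (δ (φ (ψ j)))) ∧
              (∀ w ∈ Λ'' j, w ∉ S (φ (ψ j)) (n (φ (ψ j))) ∪ T (φ (ψ j)) (n' (φ (ψ j)))) ∧
              (∀ w ∈ Λ'' j, ∀ y ∈ Λ'' j, hexGraph.Adj w y →
                (hexDomainGraph D.carrier (δ (φ (ψ j)))).Adj w y) ∧
              q (φ (ψ j)) ∈ Λ'' j ∧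
              pu j ∈ S (φ (ψ j)) (n (φ (ψ j))) ∪ T (φ (ψ j)) (n' (φ (ψ j))) ∧
              pv j ∈ S (φ (ψ j)) (n (φ (ψ j))) ∪ T (φ (ψ j)) (n' (φ (ψ j))) ∧
              hexGraph.Adj (q (φ (ψ j))) (pu j) ∧
              s(q (φ (ψ j)), pu j) ≠ s(q' (φ (ψ j)), pv j) ∧
              (a' (δ (φ (ψ j)))).map (fun w : HexVertex => ((x j + w.1, w.2) : HexVertex)) =
                s(q (φ (ψ j)), pu j) ∧
              (b' (δ (φ (ψ j)))).map (fun w : HexVertex => ((x j + w.1, w.2) : HexVertex)) =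
                s(q' (φ (ψ j)), pv j)) ∧
            (∀ᶠ j : ℕ in atTop, 1 - ε' ≤
              (carvedLaw D.carrier (δ (φ (ψ j))) (S (φ (ψ j)) (n (φ (ψ j))) ∪ T (φ (ψ j)) (n' (φ (ψ j))))
                (q (φ (ψ j))) (q' (φ (ψ j))) {ξ | ∀ w ∈ ξ.walk.support, w ∈ Λ'' j}).toReal))) →
    ((∀ (D D' : DobrushinDomain) (ρ : ℝ) (φ : ConformalEquiv upperHalfPlaneSet D.carrier)
      (Φ : ConformalEquiv (upperHalfPlaneSet \ φ.pullbackHull D') upperHalfPlaneSet) (d : ℝ)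
      (Λ Λ' : ℝ → Finset HexVertex) (m₀ m₁ m₁' : ℝ → ℤ) (a b : ℝ → Sym2 HexVertex),
      (0 < ρ ∧ ∀ i : Fin 2, D.carrier ∩ ball (D.pt i) ρ = {z : ℂ | (D.pt i).im < z.im} ∩ ball (D.pt i) ρ) →
      D.IsHullSubdomain D' → D.IsChordalUniformizing φ →
      IsRestrictionMap (φ.pullbackHull D') Φ → HasRestrictionDeriv (φ.pullbackHull D') Φ d →
      (∀ᶠ δ : ℝ in 𝓝[>] 0,
        Λ' δ ⊆ Λ δ ∧ hexDomainSimplyConnected (Λ δ) ∧ hexDomainSimplyConnected (Λ' δ) ∧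
        (hexGraph.induce (↑(Λ δ) : Set HexVertex)).Preconnected ∧
        (hexGraph.induce (↑(Λ' δ) : Set HexVertex)).Preconnected ∧
        a δ ∈ hexDomainBoundary (Λ δ) ∧ b δ ∈ hexDomainBoundary (Λ δ) ∧
        a δ ∈ hexDomainBoundary (Λ' δ) ∧ b δ ∈ hexDomainBoundary (Λ' δ) ∧
        Nonempty (HexMidEdgeSAW (Λ' δ) (a δ) (b δ)) ∧
        (∀ v ∈ Λ δ, (δ : ℂ) * hexCenter v ∈ D.carrier) ∧
        (∀ v ∈ Λ' δ, (δ : ℂ) * hexCenter v ∈ D'.carrier) ∧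
        (∀ v : HexVertex, (δ : ℂ) * hexCenter v ∈ ball (D.pt 0) ρ →
          ((v ∈ Λ δ ↔ m₀ δ ≤ v.1 1) ∧ (v ∈ Λ' δ ↔ m₀ δ ≤ v.1 1))) ∧
        (∀ v : HexVertex, (δ : ℂ) * hexCenter v ∈ ball (D.pt 1) ρ →
          ((v ∈ Λ δ ↔ m₁ δ ≤ v.1 1) ∧ (v ∈ Λ' δ ↔ m₁' δ ≤ v.1 1)))) →
      (∀ K : Set ℂ, IsCompact K → K ⊆ D.carrier →
        ∀ᶠ δ : ℝ in 𝓝[>] 0, ∀ v : HexVertex, (δ : ℂ) * hexCenter v ∈ K → v ∈ Λ δ) →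
      (∀ K : Set ℂ, IsCompact K → K ⊆ D'.carrier →
        ∀ᶠ δ : ℝ in 𝓝[>] 0, ∀ v : HexVertex, (δ : ℂ) * hexCenter v ∈ K → v ∈ Λ' δ) →
      Tendsto (fun δ : ℝ => (δ : ℂ) * hexMidpoint (a δ)) (𝓝[>] 0) (𝓝 (D.pt 0)) →
      Tendsto (fun δ : ℝ => (δ : ℂ) * hexMidpoint (b δ)) (𝓝[>] 0) (𝓝 (D.pt 1)) →
      Tendsto (fun δ : ℝ =>
          (∑ γ : HexMidEdgeSAW (Λ' δ) (a δ) (b δ), hexCriticalFugacity ^ γ.length) /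
            (∑ γ : HexMidEdgeSAW (Λ δ) (a δ) (b δ), hexCriticalFugacity ^ γ.length)) (𝓝[>] 0)
        (𝓝 (d ^ ((5 : ℝ) / 8)))) →
  ∀ (D : DobrushinDomain) (a b : ℝ → HexVertex), IsEmbEndpointApprox hexGraph hexCenter D a b →
    ∀ (ν : Measure (CurveClass ℂ)), IsSLELaw ((8 : ℝ≥0) / 3) D ν →
    ∀ (f : CurveClass ℂ →ᵇ ℝ) (ε : ℝ), 0 < ε →
      ∃ R₀ > (0 : ℝ), ∀ R ∈ Set.Ioc (0 : ℝ) R₀, ∀ ρ > (0 : ℝ), ∀ N : ℕ,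
        ∀ (δ : ℕ → ℝ) (S T : ℕ → ℕ → Set HexVertex) (n n' : ℕ → ℕ) (q q' : ℕ → HexVertex),
          Tendsto δ atTop (𝓝[>] 0) →
          (∀ k, TameNestedFamily (δ k) R N (a (δ k)) (S k) ∧
            TameNestedFamily (δ k) R N (b (δ k)) (T k) ∧
            (((∀ i, ExteriorAnchored D.carrier (δ k) (S k i) (a (δ k))) ∧
(∀ i, ExteriorAnchored D.carrier (δ k) (T k i) (b (δ k))) ∧
(∀ (i : ℕ) (p q : HexVertex), HasCleanWindow D.carrier (δ k) ρ (S k i) p q →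
  rowOf 0 q = rowOf 0 p + 1 ∧
    ∀ x : HexVertex, ((δ k : ℝ) : ℂ) * hexCenter x ∈ ball (((δ k : ℝ) : ℂ) * hexCenter q) ρ →
      (x ∈ S k i ↔ rowOf 0 x ≤ rowOf 0 p)) ∧
(∀ (i : ℕ) (p q : HexVertex), HasCleanWindow D.carrier (δ k) ρ (T k i) p q →
  rowOf 0 q = rowOf 0 p + 1 ∧
    ∀ x : HexVertex, ((δ k : ℝ) : ℂ) * hexCenter x ∈ ball (((δ k : ℝ) : ℂ) * hexCenter q) ρ →
      (x ∈ T k i ↔ rowOf 0 x ≤ rowOf 0 p))) ∧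
(∀ (i : ℕ) (p q : HexVertex), HasCleanWindow D.carrier (δ k) ρ (S k i) p q →
  ∃ K : Set ℂ, IsCompact K ∧ IsConnected K ∧
    ((δ k : ℝ) : ℂ) * hexCenter q - ((ρ / 2 : ℝ) : ℂ) * Complex.I ∈ K ∧ ((δ k : ℝ) : ℂ) * hexCenter (a (δ k)) ∈ K ∧
    ∀ v : HexVertex, Metric.infDist (((δ k : ℝ) : ℂ) * hexCenter v) K ≤ ρ / 4 → v ∈ S k i) ∧
(∀ (i : ℕ) (p q : HexVertex), HasCleanWindow D.carrier (δ k) ρ (T k i) p q →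
  ∃ K : Set ℂ, IsCompact K ∧ IsConnected K ∧
    ((δ k : ℝ) : ℂ) * hexCenter q - ((ρ / 2 : ℝ) : ℂ) * Complex.I ∈ K ∧ ((δ k : ℝ) : ℂ) * hexCenter (b (δ k)) ∈ K ∧
    ∀ v : HexVertex, Metric.infDist (((δ k : ℝ) : ℂ) * hexCenter v) K ≤ ρ / 4 → v ∈ T k i) ∧
(∀ i : ℕ, ∃ K : Set ℂ, IsCompact K ∧ IsConnected K ∧ ((δ k : ℝ) : ℂ) * hexCenter (a (δ k)) ∈ K ∧
  (∀ v : HexVertex, Metric.infDist (((δ k : ℝ) : ℂ) * hexCenter v) K ≤ ρ / 8 → v ∈ S k i) ∧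
  (∀ v ∈ S k i, ∃ (t w : HexVertex) (r : ℕ), v ∈ hexBall t r ∧ w ∈ hexBall t r ∧
    hexBall t r ⊆ S k i ∧ Metric.infDist (((δ k : ℝ) : ℂ) * hexCenter w) K ≤ ρ / 16)) ∧
(∀ i : ℕ, ∃ K : Set ℂ, IsCompact K ∧ IsConnected K ∧ ((δ k : ℝ) : ℂ) * hexCenter (b (δ k)) ∈ K ∧
  (∀ v : HexVertex, Metric.infDist (((δ k : ℝ) : ℂ) * hexCenter v) K ≤ ρ / 8 → v ∈ T k i) ∧
  (∀ v ∈ T k i, ∃ (t w : HexVertex) (r : ℕ), v ∈ hexBall t r ∧ w ∈ hexBall t r ∧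
    hexBall t r ⊆ T k i ∧ Metric.infDist (((δ k : ℝ) : ℂ) * hexCenter w) K ≤ ρ / 16)))) →
          (∀ k, ∃ (γ : HexDomainSAW D.carrier (δ k) (a (δ k)) (b (δ k))) (m : ℕ) (p : HexVertex)
              (m' : ℕ) (p' : HexVertex),
            IsFirstGoodGateN D.carrier (δ k) ρ R (S k) (a (δ k)) γ.walk.support (n k) m p (q k) ∧
            IsFirstGoodGateN D.carrier (δ k) ρ R (T k) (b (δ k)) γ.walk.support.reverse
              (n' k) m' p' (q' k) ∧
            WideLink D.carrier (δ k) ρ (S k (n k) ∪ T k (n' k)) (q k) (q' k)) →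
          (∀ k, IsProbabilityMeasure
            (carvedLaw D.carrier (δ k) (S k (n k) ∪ T k (n' k)) (q k) (q' k))) →
          (∀ η > (0 : ℝ), ∃ 𝒦 : Set (CurveClass ℂ), IsCompact 𝒦 ∧ ∀ᶠ k in atTop,
            carvedLaw D.carrier (δ k) (S k (n k) ∪ T k (n' k)) (q k) (q' k)
              {ξ | ξ.curve ∉ 𝒦} ≤ ENNReal.ofReal η) →
          (∀ ε' > (0 : ℝ), ∀ η > (0 : ℝ), ∃ θ > (0 : ℝ), ∀ᶠ k in atTop,
            carvedLaw D.carrier (δ k) (S k (n k) ∪ T k (n' k)) (q k) (q' k)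
              {ξ | ξ.curve ∉ CurveClass.modulusClass ε' θ} ≤ ENNReal.ofReal η) →
          ∀ᶠ k in atTop,
            |(∫ ξ, f ξ.curve ∂(carvedLaw D.carrier (δ k) (S k (n k) ∪ T k (n' k)) (q k) (q' k))) -
                ∫ x, f x ∂ν| ≤ ε) := by
  intro hSqueeze hARL
  exact Summit.CriticalPhenomena.SAWScalingLimit.Theorems.ObservableToSLE.TypeLadder.stub_carvedReduction_assemblyP
    (fun (D : DobrushinDomain) (a b : ℝ → HexVertex) (δ ρ : ℝ) (_R : ℝ) (_N : ℕ)
      (S T : ℕ → Set HexVertex) =>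
      ((∀ n, ExteriorAnchored D.carrier δ (S n) (a δ)) ∧
        (∀ n, ExteriorAnchored D.carrier δ (T n) (b δ)) ∧
        (∀ (n : ℕ) (p q : HexVertex), HasCleanWindow D.carrier δ ρ (S n) p q →
          rowOf 0 q = rowOf 0 p + 1 ∧
            ∀ x : HexVertex, (δ : ℂ) * hexCenter x ∈ ball ((δ : ℂ) * hexCenter q) ρ →
              (x ∈ S n ↔ rowOf 0 x ≤ rowOf 0 p)) ∧
        (∀ (n : ℕ) (p q : HexVertex), HasCleanWindow D.carrier δ ρ (T n) p q →
          rowOf 0 q = rowOf 0 p + 1 ∧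
            ∀ x : HexVertex, (δ : ℂ) * hexCenter x ∈ ball ((δ : ℂ) * hexCenter q) ρ →
              (x ∈ T n ↔ rowOf 0 x ≤ rowOf 0 p))) ∧
      (∀ (n : ℕ) (p q : HexVertex), HasCleanWindow D.carrier δ ρ (S n) p q →
        ∃ K : Set ℂ, IsCompact K ∧ IsConnected K ∧
          (δ : ℂ) * hexCenter q - ((ρ / 2 : ℝ) : ℂ) * Complex.I ∈ K ∧ (δ : ℂ) * hexCenter (a δ) ∈ K ∧
          ∀ v : HexVertex, Metric.infDist ((δ : ℂ) * hexCenter v) K ≤ ρ / 4 → v ∈ S n) ∧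
      (∀ (n : ℕ) (p q : HexVertex), HasCleanWindow D.carrier δ ρ (T n) p q →
        ∃ K : Set ℂ, IsCompact K ∧ IsConnected K ∧
          (δ : ℂ) * hexCenter q - ((ρ / 2 : ℝ) : ℂ) * Complex.I ∈ K ∧ (δ : ℂ) * hexCenter (b δ) ∈ K ∧
          ∀ v : HexVertex, Metric.infDist ((δ : ℂ) * hexCenter v) K ≤ ρ / 4 → v ∈ T n) ∧
      (∀ i : ℕ, ∃ K : Set ℂ, IsCompact K ∧ IsConnected K ∧ (δ : ℂ) * hexCenter (a δ) ∈ K ∧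
        (∀ v : HexVertex, Metric.infDist ((δ : ℂ) * hexCenter v) K ≤ ρ / 8 → v ∈ S i) ∧
        (∀ v ∈ S i, ∃ (t w : HexVertex) (r : ℕ), v ∈ hexBall t r ∧ w ∈ hexBall t r ∧
          hexBall t r ⊆ S i ∧ Metric.infDist ((δ : ℂ) * hexCenter w) K ≤ ρ / 16)) ∧
      (∀ i : ℕ, ∃ K : Set ℂ, IsCompact K ∧ IsConnected K ∧ (δ : ℂ) * hexCenter (b δ) ∈ K ∧
        (∀ v : HexVertex, Metric.infDist ((δ : ℂ) * hexCenter v) K ≤ ρ / 8 → v ∈ T i) ∧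
        (∀ v ∈ T i, ∃ (t w : HexVertex) (r : ℕ), v ∈ hexBall t r ∧ w ∈ hexBall t r ∧
          hexBall t r ⊆ T i ∧ Metric.infDist ((δ : ℂ) * hexCenter w) K ≤ ρ / 16)))
    (hSqueeze hARL) (Summit.CriticalPhenomena.SAWScalingLimit.Theorems.ObservableToSLE.TypeLadder.stub_twoPieceAdmIdentification hARL)
    Summit.CriticalPhenomena.SAWScalingLimit.Theorems.ObservableToSLER.BridgeGate.stub_sleLawContinuity

/-! ## §3 REGISTERED STUBS of the line `macro-anchor-split` -/

/-- STUB 1 (= live S1 `stub_nestedRenewalFatCoSolidR`, SAME name and signature; OPEN research — renewal ABUNDANCE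
with fat co-oriented solid tame families, locality scale bounded). -/
theorem stub_nestedRenewalFatCoSolidR :
    ∀ (D : DobrushinDomain) (a b : ℝ → HexVertex), IsEmbEndpointApprox hexGraph hexCenter D a b →
      ∀ ε > (0 : ℝ), ∃ R₂ > (0 : ℝ), ∀ R ∈ Set.Ioc (0 : ℝ) R₂, ∃ ρ > (0 : ℝ), ∃ N : ℕ, ∀ᶠ δ : ℝ in 𝓝[>] 0,
        ∃ S T : ℕ → Set HexVertex,
          TameNestedFamily δ R N (a δ) S ∧ TameNestedFamily δ R N (b δ) T ∧
          ((∀ n, ExteriorAnchored D.carrier δ (S n) (a δ)) ∧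
            (∀ n, ExteriorAnchored D.carrier δ (T n) (b δ)) ∧
            ∃ j : Fin 6,
              ((∀ (n : ℕ) (p q : HexVertex), HasCleanWindow D.carrier δ ρ (S n) p q →
                  rowOf j q = rowOf j p + 1 ∧
                    ∀ x : HexVertex, (δ : ℂ) * hexCenter x ∈ ball ((δ : ℂ) * hexCenter q) ρ →
                      (x ∈ S n ↔ rowOf j x ≤ rowOf j p)) ∧
                (∀ (n : ℕ) (p q : HexVertex), HasCleanWindow D.carrier δ ρ (T n) p q →
                  rowOf j q = rowOf j p + 1 ∧
                    ∀ x : HexVertex, (δ : ℂ) * hexCenter x ∈ ball ((δ : ℂ) * hexCenter q) ρ →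
                      (x ∈ T n ↔ rowOf j x ≤ rowOf j p))) ∧
              (∀ (n : ℕ) (p q : HexVertex), HasCleanWindow D.carrier δ ρ (S n) p q →
                ∃ K : Set ℂ, IsCompact K ∧ IsConnected K ∧
                  (δ : ℂ) * hexCenter q - ((ρ / 2 : ℝ) : ℂ) * Complex.I * triZeta ^ (j : ℕ) ∈ K ∧
                  (δ : ℂ) * hexCenter (a δ) ∈ K ∧
                  ∀ v : HexVertex, Metric.infDist ((δ : ℂ) * hexCenter v) K ≤ ρ / 4 → v ∈ S n) ∧
              (∀ (n : ℕ) (p q : HexVertex), HasCleanWindow D.carrier δ ρ (T n) p q →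
                ∃ K : Set ℂ, IsCompact K ∧ IsConnected K ∧
                  (δ : ℂ) * hexCenter q - ((ρ / 2 : ℝ) : ℂ) * Complex.I * triZeta ^ (j : ℕ) ∈ K ∧
                  (δ : ℂ) * hexCenter (b δ) ∈ K ∧
                  ∀ v : HexVertex, Metric.infDist ((δ : ℂ) * hexCenter v) K ≤ ρ / 4 → v ∈ T n) ∧
              (∀ n : ℕ, ∃ K : Set ℂ, IsCompact K ∧ IsConnected K ∧ (δ : ℂ) * hexCenter (a δ) ∈ K ∧
                (∀ v : HexVertex, Metric.infDist ((δ : ℂ) * hexCenter v) K ≤ ρ / 8 → v ∈ S n) ∧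
                (∀ v ∈ S n, ∃ (t w : HexVertex) (r : ℕ), v ∈ hexBall t r ∧ w ∈ hexBall t r ∧
                  hexBall t r ⊆ S n ∧ Metric.infDist ((δ : ℂ) * hexCenter w) K ≤ ρ / 16)) ∧
              (∀ n : ℕ, ∃ K : Set ℂ, IsCompact K ∧ IsConnected K ∧ (δ : ℂ) * hexCenter (b δ) ∈ K ∧
                (∀ v : HexVertex, Metric.infDist ((δ : ℂ) * hexCenter v) K ≤ ρ / 8 → v ∈ T n) ∧
                (∀ v ∈ T n, ∃ (t w : HexVertex) (r : ℕ), v ∈ hexBall t r ∧ w ∈ hexBall t r ∧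
                  hexBall t r ⊆ T n ∧ Metric.infDist ((δ : ℂ) * hexCenter w) K ≤ ρ / 16))) ∧
          hexSAWLaw D.carrier δ (a δ) (b δ)
              {γ | ¬ ∃ (n m : ℕ) (p q : HexVertex) (n' m' : ℕ) (p' q' : HexVertex),
                  IsFirstGoodGateN D.carrier δ ρ R S (a δ) γ.walk.support n m p q ∧
                  IsFirstGoodGateN D.carrier δ ρ R T (b δ) γ.walk.support.reverse n' m' p' q' ∧
                  WideLink D.carrier δ ρ (S n ∪ T n') q q'} ≤
            ENNReal.ofReal ε := by
  sorry

/-- STUB 2 (NEW; OPEN research, Conjecture-1-locked in substance) — MACROSCOPIC SOURCE LOCALITY, the weakened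
anchor (replaces the K-uniform `stub_twoPieceSourceLocality`, which implies it:
`macroSourceLocality_of_twoPieceSourceLocality`). -/
theorem stub_macroSourceLocality :
    ∀ (E : DobrushinDomain) (ρ : ℝ) (Λ : ℝ → Finset HexVertex) (m₀ : ℝ → ℤ)
      (a : ℝ → Sym2 HexVertex),
      0 < ρ → E.carrier ∩ ball (E.pt 0) ρ = {z : ℂ | (E.pt 0).im < z.im} ∩ ball (E.pt 0) ρ →
      (∀ᶠ δ : ℝ in 𝓝[>] 0, hexDomainSimplyConnected (Λ δ) ∧
        (hexGraph.induce (↑(Λ δ) : Set HexVertex)).Preconnected ∧ a δ ∈ hexDomainBoundary (Λ δ) ∧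
        (∀ v ∈ Λ δ, (δ : ℂ) * hexCenter v ∈ E.carrier) ∧
        (∀ v : HexVertex, (δ : ℂ) * hexCenter v ∈ ball (E.pt 0) ρ → (v ∈ Λ δ ↔ m₀ δ ≤ v.1 1))) →
      (∀ K : Set ℂ, IsCompact K → K ⊆ E.carrier →
        ∀ᶠ δ : ℝ in 𝓝[>] 0, ∀ v : HexVertex, (δ : ℂ) * hexCenter v ∈ K → v ∈ Λ δ) →
      Tendsto (fun δ : ℝ => (δ : ℂ) * hexMidpoint (a δ)) (𝓝[>] 0) (𝓝 (E.pt 0)) →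
      ∀ ε : ℝ, 0 < ε → ∀ r : ℝ, 0 < r → ∃ t₀ : ℝ, 0 < t₀ ∧
        ∀ (s : ℝ → Sym2 HexVertex) (t : ℝ), t ≠ 0 → |t| < t₀ →
          (∀ᶠ δ : ℝ in 𝓝[>] 0, s δ ∈ hexDomainBoundary (Λ δ) ∧
            (hexMidpoint (s δ)).im = (hexMidpoint (a δ)).im) →
          Tendsto (fun δ : ℝ => (δ : ℂ) * hexMidpoint (s δ)) (𝓝[>] 0) (𝓝 (E.pt 0 + t)) →
          ∀ᶠ δ : ℝ in 𝓝[>] 0,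
            (∑ γ : HexMidEdgeSAW (Λ δ) (a δ) (s δ),
                if ∃ v ∈ γ.verts, r ≤ dist ((δ : ℂ) * hexCenter v) ((δ : ℂ) * hexMidpoint (a δ))
                then hexCriticalFugacity ^ γ.length else 0) ≤
              ε * ∑ γ : HexMidEdgeSAW (Λ δ) (a δ) (s δ), hexCriticalFugacity ^ γ.length := by
  sorry

/-- STUB 3 (= live T5ₐ `stub_hexSimpleSubseqLimits` = item stmt-CriticalPhenomena-7148, SAME name and signature;
OPEN research, Conjecture-1-locked) — SIMPLICITY of subsequential limits. -/
theorem stub_hexSimpleSubseqLimits :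
    ∀ (D : DobrushinDomain) (a b : ℝ → HexVertex), IsEmbEndpointApprox hexGraph hexCenter D a b →
      ∀ (s : ℕ → ℝ) (ν : Measure (CurveClass ℂ)), Tendsto s atTop (𝓝[>] 0) → IsProbabilityMeasure ν →
        (∀ f : CurveClass ℂ →ᵇ ℝ,
          Tendsto (fun n => ∫ γ, f γ.curve ∂(hexSAWLaw D.carrier (s n) (a (s n)) (b (s n)))) atTop
            (𝓝 (∫ x, f x ∂ν))) →
        ∀ᵐ γ ∂ν, γ ∈ CurveClass.simple ∧ γ.source = D.pt 0 ∧ γ.target = D.pt 1 ∧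
          γ.range ⊆ closure D.carrier ∧ γ.range ∩ frontier D.carrier ⊆ {D.pt 0, D.pt 1} := by
  sorry

/-- STUB 4 (NEW; PROVABLE, XL) — CARVED IDENTIFICATION FOR SOLID CLASS-ZERO FAMILIES from ARL″
(`TwoPieceAdmRestrictionLimit → CarvedSeqIdentificationPM FatAnchoredClassZeroSolid`, inlined).  Closable from
the live T2b″ `stub_carvedReduction_squeezeSolid` by `carvedIdentificationSolid_of_squeezeSolid` (§2). -/
theorem stub_carvedIdentificationSolid :
    (∀ (D D' : DobrushinDomain) (ρ : ℝ) (φ : ConformalEquiv upperHalfPlaneSet D.carrier)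
          (Φ : ConformalEquiv (upperHalfPlaneSet \ φ.pullbackHull D') upperHalfPlaneSet) (d : ℝ)
          (Λ Λ' : ℝ → Finset HexVertex) (m₀ m₁ m₁' : ℝ → ℤ) (a b : ℝ → Sym2 HexVertex),
          (0 < ρ ∧ ∀ i : Fin 2, D.carrier ∩ ball (D.pt i) ρ = {z : ℂ | (D.pt i).im < z.im} ∩ ball (D.pt i) ρ) →
          D.IsHullSubdomain D' → D.IsChordalUniformizing φ →
          IsRestrictionMap (φ.pullbackHull D') Φ → HasRestrictionDeriv (φ.pullbackHull D') Φ d →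
          (∀ᶠ δ : ℝ in 𝓝[>] 0,
            Λ' δ ⊆ Λ δ ∧ hexDomainSimplyConnected (Λ δ) ∧ hexDomainSimplyConnected (Λ' δ) ∧
            (hexGraph.induce (↑(Λ δ) : Set HexVertex)).Preconnected ∧
            (hexGraph.induce (↑(Λ' δ) : Set HexVertex)).Preconnected ∧
            a δ ∈ hexDomainBoundary (Λ δ) ∧ b δ ∈ hexDomainBoundary (Λ δ) ∧
            a δ ∈ hexDomainBoundary (Λ' δ) ∧ b δ ∈ hexDomainBoundary (Λ' δ) ∧
            Nonempty (HexMidEdgeSAW (Λ' δ) (a δ) (b δ)) ∧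
            (∀ v ∈ Λ δ, (δ : ℂ) * hexCenter v ∈ D.carrier) ∧
            (∀ v ∈ Λ' δ, (δ : ℂ) * hexCenter v ∈ D'.carrier) ∧
            (∀ v : HexVertex, (δ : ℂ) * hexCenter v ∈ ball (D.pt 0) ρ →
              ((v ∈ Λ δ ↔ m₀ δ ≤ v.1 1) ∧ (v ∈ Λ' δ ↔ m₀ δ ≤ v.1 1))) ∧
            (∀ v : HexVertex, (δ : ℂ) * hexCenter v ∈ ball (D.pt 1) ρ →
              ((v ∈ Λ δ ↔ m₁ δ ≤ v.1 1) ∧ (v ∈ Λ' δ ↔ m₁' δ ≤ v.1 1)))) →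
          (∀ K : Set ℂ, IsCompact K → K ⊆ D.carrier →
            ∀ᶠ δ : ℝ in 𝓝[>] 0, ∀ v : HexVertex, (δ : ℂ) * hexCenter v ∈ K → v ∈ Λ δ) →
          (∀ K : Set ℂ, IsCompact K → K ⊆ D'.carrier →
            ∀ᶠ δ : ℝ in 𝓝[>] 0, ∀ v : HexVertex, (δ : ℂ) * hexCenter v ∈ K → v ∈ Λ' δ) →
          Tendsto (fun δ : ℝ => (δ : ℂ) * hexMidpoint (a δ)) (𝓝[>] 0) (𝓝 (D.pt 0)) →
          Tendsto (fun δ : ℝ => (δ : ℂ) * hexMidpoint (b δ)) (𝓝[>] 0) (𝓝 (D.pt 1)) →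
          Tendsto (fun δ : ℝ =>
              (∑ γ : HexMidEdgeSAW (Λ' δ) (a δ) (b δ), hexCriticalFugacity ^ γ.length) /
                (∑ γ : HexMidEdgeSAW (Λ δ) (a δ) (b δ), hexCriticalFugacity ^ γ.length)) (𝓝[>] 0)
            (𝓝 (d ^ ((5 : ℝ) / 8)))) →
      ∀ (D : DobrushinDomain) (a b : ℝ → HexVertex), IsEmbEndpointApprox hexGraph hexCenter D a b →
        ∀ (ν : Measure (CurveClass ℂ)), IsSLELaw ((8 : ℝ≥0) / 3) D ν →
        ∀ (f : CurveClass ℂ →ᵇ ℝ) (ε : ℝ), 0 < ε →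
          ∃ R₀ > (0 : ℝ), ∀ R ∈ Set.Ioc (0 : ℝ) R₀, ∀ ρ > (0 : ℝ), ∀ N : ℕ,
            ∀ (δ : ℕ → ℝ) (S T : ℕ → ℕ → Set HexVertex) (n n' : ℕ → ℕ) (q q' : ℕ → HexVertex),
              Tendsto δ atTop (𝓝[>] 0) →
              (∀ k, TameNestedFamily (δ k) R N (a (δ k)) (S k) ∧
                TameNestedFamily (δ k) R N (b (δ k)) (T k) ∧
                (((∀ i, ExteriorAnchored D.carrier (δ k) (S k i) (a (δ k))) ∧
    (∀ i, ExteriorAnchored D.carrier (δ k) (T k i) (b (δ k))) ∧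
    (∀ (i : ℕ) (p q : HexVertex), HasCleanWindow D.carrier (δ k) ρ (S k i) p q →
      rowOf 0 q = rowOf 0 p + 1 ∧
        ∀ x : HexVertex, ((δ k : ℝ) : ℂ) * hexCenter x ∈ ball (((δ k : ℝ) : ℂ) * hexCenter q) ρ →
          (x ∈ S k i ↔ rowOf 0 x ≤ rowOf 0 p)) ∧
    (∀ (i : ℕ) (p q : HexVertex), HasCleanWindow D.carrier (δ k) ρ (T k i) p q →
      rowOf 0 q = rowOf 0 p + 1 ∧
        ∀ x : HexVertex, ((δ k : ℝ) : ℂ) * hexCenter x ∈ ball (((δ k : ℝ) : ℂ) * hexCenter q) ρ →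
          (x ∈ T k i ↔ rowOf 0 x ≤ rowOf 0 p))) ∧
    (∀ (i : ℕ) (p q : HexVertex), HasCleanWindow D.carrier (δ k) ρ (S k i) p q →
      ∃ K : Set ℂ, IsCompact K ∧ IsConnected K ∧
        ((δ k : ℝ) : ℂ) * hexCenter q - ((ρ / 2 : ℝ) : ℂ) * Complex.I ∈ K ∧ ((δ k : ℝ) : ℂ) * hexCenter (a (δ k)) ∈ K ∧
        ∀ v : HexVertex, Metric.infDist (((δ k : ℝ) : ℂ) * hexCenter v) K ≤ ρ / 4 → v ∈ S k i) ∧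
    (∀ (i : ℕ) (p q : HexVertex), HasCleanWindow D.carrier (δ k) ρ (T k i) p q →
      ∃ K : Set ℂ, IsCompact K ∧ IsConnected K ∧
        ((δ k : ℝ) : ℂ) * hexCenter q - ((ρ / 2 : ℝ) : ℂ) * Complex.I ∈ K ∧ ((δ k : ℝ) : ℂ) * hexCenter (b (δ k)) ∈ K ∧
        ∀ v : HexVertex, Metric.infDist (((δ k : ℝ) : ℂ) * hexCenter v) K ≤ ρ / 4 → v ∈ T k i) ∧
    (∀ i : ℕ, ∃ K : Set ℂ, IsCompact K ∧ IsConnected K ∧ ((δ k : ℝ) : ℂ) * hexCenter (a (δ k)) ∈ K ∧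
      (∀ v : HexVertex, Metric.infDist (((δ k : ℝ) : ℂ) * hexCenter v) K ≤ ρ / 8 → v ∈ S k i) ∧
      (∀ v ∈ S k i, ∃ (t w : HexVertex) (r : ℕ), v ∈ hexBall t r ∧ w ∈ hexBall t r ∧
        hexBall t r ⊆ S k i ∧ Metric.infDist (((δ k : ℝ) : ℂ) * hexCenter w) K ≤ ρ / 16)) ∧
    (∀ i : ℕ, ∃ K : Set ℂ, IsCompact K ∧ IsConnected K ∧ ((δ k : ℝ) : ℂ) * hexCenter (b (δ k)) ∈ K ∧
      (∀ v : HexVertex, Metric.infDist (((δ k : ℝ) : ℂ) * hexCenter v) K ≤ ρ / 8 → v ∈ T k i) ∧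
      (∀ v ∈ T k i, ∃ (t w : HexVertex) (r : ℕ), v ∈ hexBall t r ∧ w ∈ hexBall t r ∧
        hexBall t r ⊆ T k i ∧ Metric.infDist (((δ k : ℝ) : ℂ) * hexCenter w) K ≤ ρ / 16)))) →
              (∀ k, ∃ (γ : HexDomainSAW D.carrier (δ k) (a (δ k)) (b (δ k))) (m : ℕ) (p : HexVertex)
                  (m' : ℕ) (p' : HexVertex),
                IsFirstGoodGateN D.carrier (δ k) ρ R (S k) (a (δ k)) γ.walk.support (n k) m p (q k) ∧
                IsFirstGoodGateN D.carrier (δ k) ρ R (T k) (b (δ k)) γ.walk.support.reverse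
                  (n' k) m' p' (q' k) ∧
                WideLink D.carrier (δ k) ρ (S k (n k) ∪ T k (n' k)) (q k) (q' k)) →
              (∀ k, IsProbabilityMeasure
                (carvedLaw D.carrier (δ k) (S k (n k) ∪ T k (n' k)) (q k) (q' k))) →
              (∀ η > (0 : ℝ), ∃ 𝒦 : Set (CurveClass ℂ), IsCompact 𝒦 ∧ ∀ᶠ k in atTop,
                carvedLaw D.carrier (δ k) (S k (n k) ∪ T k (n' k)) (q k) (q' k)
                  {ξ | ξ.curve ∉ 𝒦} ≤ ENNReal.ofReal η) →
              (∀ ε' > (0 : ℝ), ∀ η > (0 : ℝ), ∃ θ > (0 : ℝ), ∀ᶠ k in atTop,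
                carvedLaw D.carrier (δ k) (S k (n k) ∪ T k (n' k)) (q k) (q' k)
                  {ξ | ξ.curve ∉ CurveClass.modulusClass ε' θ} ≤ ENNReal.ofReal η) →
              ∀ᶠ k in atTop,
                |(∫ ξ, f ξ.curve ∂(carvedLaw D.carrier (δ k) (S k (n k) ∪ T k (n' k)) (q k) (q' k))) -
                    ∫ x, f x ∂ν| ≤ ε := by
  sorry

/-! ## §4 Composition (sorry-free over the stubs): the skeleton concludes the crux BY NAME -/

/-- **`ObservableToSLE` from the four registered stubs of `macro-anchor-split`.**  `HexObservableLimit` enters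
only through `macroRestrictionLimit` (with stub 2); stub 4 gives the class-`(0,0)` carved sequential
identification, transported to the co-oriented solid class (twin, landed); stub 3 with `HexTight` gives the
uniform injectivity modulus (landed), whence averaged modulus and tightness of the carved middle pieces and the
sequential reduction (landed); the nested transfer (landed) turns stub 1 + carved convergence into identification
of every subsequential limit, and `convergesInLawToSLE_of_identification` concludes with `HexTight`.  (The same
composition with the four inputs as explicit hypotheses — the route-level split glue `ObservableToSLE_of_subs` — is
kernel-checked in the evidence file `SAWDevelopingMapObservableToSLESplit.lean` on the crux item.) -/
theorem ObservableToSLE_of : ObservableToSLE := by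
  intro hO hT D a b hab
  have hRen := stub_nestedRenewalFatCoSolidR
  have hMacro := stub_macroSourceLocality
  have hSimple := stub_hexSimpleSubseqLimits
  have hRed := stub_carvedIdentificationSolid
  have hARL := macroRestrictionLimit hO hMacro
  have hCSI0 := hRed hARL
  have hCSIco := Summit.CriticalPhenomena.SAWScalingLimit.Theorems.ObservableToSLER.CoOrientedSolid.stub_coOrientedReductionSolid hCSI0
  have hUM := Summit.CriticalPhenomena.SAWScalingLimit.Theorems.ObservableToSLER.Modulus.stub_hexUniformModulus_of_simpleLimits hT hSimple
  have hCarved := Summit.CriticalPhenomena.SAWScalingLimit.Theorems.ObservableToSLER.NestedGate.stub_seqReductionPM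
    (fun (D : DobrushinDomain) (a b : ℝ → HexVertex) (δ ρ : ℝ) (_R : ℝ) (_N : ℕ)
      (S T : ℕ → Set HexVertex) =>
      ((∀ n, ExteriorAnchored D.carrier δ (S n) (a δ)) ∧
        (∀ n, ExteriorAnchored D.carrier δ (T n) (b δ)) ∧
        ∃ j : Fin 6,
          ((∀ (n : ℕ) (p q : HexVertex), HasCleanWindow D.carrier δ ρ (S n) p q →
              rowOf j q = rowOf j p + 1 ∧
                ∀ x : HexVertex, (δ : ℂ) * hexCenter x ∈ ball ((δ : ℂ) * hexCenter q) ρ →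
                  (x ∈ S n ↔ rowOf j x ≤ rowOf j p)) ∧
            (∀ (n : ℕ) (p q : HexVertex), HasCleanWindow D.carrier δ ρ (T n) p q →
              rowOf j q = rowOf j p + 1 ∧
                ∀ x : HexVertex, (δ : ℂ) * hexCenter x ∈ ball ((δ : ℂ) * hexCenter q) ρ →
                  (x ∈ T n ↔ rowOf j x ≤ rowOf j p))) ∧
          (∀ (n : ℕ) (p q : HexVertex), HasCleanWindow D.carrier δ ρ (S n) p q →
            ∃ K : Set ℂ, IsCompact K ∧ IsConnected K ∧
              (δ : ℂ) * hexCenter q - ((ρ / 2 : ℝ) : ℂ) * Complex.I * triZeta ^ (j : ℕ) ∈ K ∧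
              (δ : ℂ) * hexCenter (a δ) ∈ K ∧
              ∀ v : HexVertex, Metric.infDist ((δ : ℂ) * hexCenter v) K ≤ ρ / 4 → v ∈ S n) ∧
          (∀ (n : ℕ) (p q : HexVertex), HasCleanWindow D.carrier δ ρ (T n) p q →
            ∃ K : Set ℂ, IsCompact K ∧ IsConnected K ∧
              (δ : ℂ) * hexCenter q - ((ρ / 2 : ℝ) : ℂ) * Complex.I * triZeta ^ (j : ℕ) ∈ K ∧
              (δ : ℂ) * hexCenter (b δ) ∈ K ∧
              ∀ v : HexVertex, Metric.infDist ((δ : ℂ) * hexCenter v) K ≤ ρ / 4 → v ∈ T n) ∧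
          (∀ n : ℕ, ∃ K : Set ℂ, IsCompact K ∧ IsConnected K ∧ (δ : ℂ) * hexCenter (a δ) ∈ K ∧
            (∀ v : HexVertex, Metric.infDist ((δ : ℂ) * hexCenter v) K ≤ ρ / 8 → v ∈ S n) ∧
            (∀ v ∈ S n, ∃ (t w : HexVertex) (r : ℕ), v ∈ hexBall t r ∧ w ∈ hexBall t r ∧
              hexBall t r ⊆ S n ∧ Metric.infDist ((δ : ℂ) * hexCenter w) K ≤ ρ / 16)) ∧
          (∀ n : ℕ, ∃ K : Set ℂ, IsCompact K ∧ IsConnected K ∧ (δ : ℂ) * hexCenter (b δ) ∈ K ∧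
            (∀ v : HexVertex, Metric.infDist ((δ : ℂ) * hexCenter v) K ≤ ρ / 8 → v ∈ T n) ∧
            (∀ v ∈ T n, ∃ (t w : HexVertex) (r : ℕ), v ∈ hexBall t r ∧ w ∈ hexBall t r ∧
              hexBall t r ⊆ T n ∧ Metric.infDist ((δ : ℂ) * hexCenter w) K ≤ ρ / 16))))
    hCSIco (Summit.CriticalPhenomena.SAWScalingLimit.Theorems.ObservableToSLER.NestedGate.stub_midTightN hT)
    (Summit.CriticalPhenomena.SAWScalingLimit.Theorems.ObservableToSLER.NestedGate.stub_midModulusN hUM)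
  have hfull := Summit.CriticalPhenomena.SAWScalingLimit.Theorems.ObservableToSLE.TypeLadder.stub_nestedTransferPR
    (fun (D : DobrushinDomain) (a b : ℝ → HexVertex) (δ ρ : ℝ) (_R : ℝ) (_N : ℕ)
      (S T : ℕ → Set HexVertex) =>
      ((∀ n, ExteriorAnchored D.carrier δ (S n) (a δ)) ∧
        (∀ n, ExteriorAnchored D.carrier δ (T n) (b δ)) ∧
        ∃ j : Fin 6,
          ((∀ (n : ℕ) (p q : HexVertex), HasCleanWindow D.carrier δ ρ (S n) p q →
              rowOf j q = rowOf j p + 1 ∧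
                ∀ x : HexVertex, (δ : ℂ) * hexCenter x ∈ ball ((δ : ℂ) * hexCenter q) ρ →
                  (x ∈ S n ↔ rowOf j x ≤ rowOf j p)) ∧
            (∀ (n : ℕ) (p q : HexVertex), HasCleanWindow D.carrier δ ρ (T n) p q →
              rowOf j q = rowOf j p + 1 ∧
                ∀ x : HexVertex, (δ : ℂ) * hexCenter x ∈ ball ((δ : ℂ) * hexCenter q) ρ →
                  (x ∈ T n ↔ rowOf j x ≤ rowOf j p))) ∧
          (∀ (n : ℕ) (p q : HexVertex), HasCleanWindow D.carrier δ ρ (S n) p q →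
            ∃ K : Set ℂ, IsCompact K ∧ IsConnected K ∧
              (δ : ℂ) * hexCenter q - ((ρ / 2 : ℝ) : ℂ) * Complex.I * triZeta ^ (j : ℕ) ∈ K ∧
              (δ : ℂ) * hexCenter (a δ) ∈ K ∧
              ∀ v : HexVertex, Metric.infDist ((δ : ℂ) * hexCenter v) K ≤ ρ / 4 → v ∈ S n) ∧
          (∀ (n : ℕ) (p q : HexVertex), HasCleanWindow D.carrier δ ρ (T n) p q →
            ∃ K : Set ℂ, IsCompact K ∧ IsConnected K ∧
              (δ : ℂ) * hexCenter q - ((ρ / 2 : ℝ) : ℂ) * Complex.I * triZeta ^ (j : ℕ) ∈ K ∧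
              (δ : ℂ) * hexCenter (b δ) ∈ K ∧
              ∀ v : HexVertex, Metric.infDist ((δ : ℂ) * hexCenter v) K ≤ ρ / 4 → v ∈ T n) ∧
          (∀ n : ℕ, ∃ K : Set ℂ, IsCompact K ∧ IsConnected K ∧ (δ : ℂ) * hexCenter (a δ) ∈ K ∧
            (∀ v : HexVertex, Metric.infDist ((δ : ℂ) * hexCenter v) K ≤ ρ / 8 → v ∈ S n) ∧
            (∀ v ∈ S n, ∃ (t w : HexVertex) (r : ℕ), v ∈ hexBall t r ∧ w ∈ hexBall t r ∧
              hexBall t r ⊆ S n ∧ Metric.infDist ((δ : ℂ) * hexCenter w) K ≤ ρ / 16)) ∧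
          (∀ n : ℕ, ∃ K : Set ℂ, IsCompact K ∧ IsConnected K ∧ (δ : ℂ) * hexCenter (b δ) ∈ K ∧
            (∀ v : HexVertex, Metric.infDist ((δ : ℂ) * hexCenter v) K ≤ ρ / 8 → v ∈ T n) ∧
            (∀ v ∈ T n, ∃ (t w : HexVertex) (r : ℕ), v ∈ hexBall t r ∧ w ∈ hexBall t r ∧
              hexBall t r ⊆ T n ∧ Metric.infDist ((δ : ℂ) * hexCenter w) K ≤ ρ / 16))))
    Summit.CriticalPhenomena.SAWScalingLimit.Theorems.ObservableToSLER.BridgeGate.stub_gateDecomposition hRen hCarved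
  exact Summit.CriticalPhenomena.SAWScalingLimit.Theorems.ObservableToSLE.Negative.convergesInLawToSLE_of_identification hab (hT D a b hab)
    (hfull D a b hab)

end Summit.CriticalPhenomena.SAWScalingLimit.Cruxes.ObservableToSLE.MacroAnchorSplit

end
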